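import Literature.NumberTheory.EllipticCurves.Tamagawa
import Literature.NumberTheory.EllipticCurves.Isogeny
import Literature.NumberTheory.EllipticCurves.TateModule
import Literature.NumberTheory.EllipticCurves.AnalyticRank
import Literature.NumberTheory.GaloisRepresentations.IntegralGaloisAction
import HarnessLib

/-!
# The residual classes of the BSD formula in analytic rank `≤ 1`: the `(E, p)` predicates

HONEST FRAMING (cell `b2b-bsdres`, run/shared/lean/b2b/bsd-rank1-residual/): the goal of the cell
is to DELETE the COMBINATION-SHAPED residual classes of the Birch–Swinnerton-Dyer formula for ALL
analytic-rank `≤ 1` elliptic curves over `ℚ` — "full BSD formula for every rank `≤ 1` curve in class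
`C`" assembled STRICTLY from published theorems — so that the rank-`≤ 1` remainder becomes exactly
the CONSTRUCTION-SHAPED classes, which are TYPED (missing-input `Prop`s), NOT attempted. This is
not "finishing BSD".

This file holds DEFINITIONS ONLY (no named fact, no theorem beyond `Iff.rfl`-level API): the
decidable predicates on a pair `(E, p)` of the lane's checklist
`run/shared/lean/speedrun/kurihara/bsdN/HYPOTHESES.md` §Predicates (v1, 2026-08-18), quoted in
`papers/BirchSwinnertonDyer/bsd-percentage/RESIDUAL-CASES.md` §a.0, and the class predicates
`X1 … X12` of RESIDUAL-CASES §a.2 (v3, 2026-08-18T17:16Z) = `CLASSES.md` of the cell. Every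
vendored theorem of the cell (files `Literature/NumberTheory/EllipticCurves/<AuthorYear>/…`) and
every class theorem (`Literature/NumberTheory/EllipticCurves/Rank1Residual/<Class>.lean`) states
its hypotheses with THESE names, so that "hypotheses as named predicates matching HYPOTHESES.md" is
literal. `E` is given by a Weierstrass model `W : WeierstrassCurve ℚ`, intended globally minimal
(`[W.IsGloballyMinimal]` is required exactly where the tree's invariant needs it: `a_p` and
`Δ_min`); `p : ℕ` with `[Fact p.Prime]`; `r = W.analyticRank`; BSD(E,p) itself is the tree's
`Literature.NumberTheory.EllipticCurves.BSDp W p` (Miller, LMS J. Comput. Math. 14 (2011) Def. 1.1;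
file `BSDRootNumberSmallConductorProofs`), not redefined here.

| HYPOTHESES.md | here | meaning (as printed there) |
|---|---|---|
| good(p) | `Good W p` | `p ∤ N` — good reduction at `p` (`WeierstrassCurve.HasGoodReductionAtPrime`) |
| mult(p) | `Mult W p` | `p ‖ N` — multiplicative reduction (`HasMultiplicativeReductionAtPrime`) |
| add(p) | `Addv W p` | `p² ∣ N` — additive reduction: neither good nor multiplicative |
| ord(p) | `GoodOrd W p` | good ∧ `p ∤ a_p` |
| ss(p) | `GoodSS W p` | good ∧ `p ∣ a_p` |
| sst | `Semistable W` | `N` square-free: every prime is good or multiplicative |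
| cm | `W.HasCM` | (tree, `Isogeny.lean`) geometric CM; CM field via `cmFieldDiscrOfJ W.j` |
| red(p) / irr(p) | `Red W p` / `Irr W p` | `E[p]` reducible (rational `p`-isogeny) / irreducible (`HasIrreducibleModPGaloisRep`) |
| surj(p) | `Surj W p` | `ρ̄_{E,p}` onto `Aut(E[p]) ≅ GL₂(𝔽_p)` (`HasSurjectiveModNGaloisRep`) |
| ram(p) | `Ram W p` | `∃ q ‖ N, q ≠ p, p ∤ v_q(Δ_min)` (⇔ `ρ̄_{E,p}` ramified at a multiplicative `q`, Tate curve), the transcription already used by bsd.S30 `padicValRat_bsd_rank_zero` |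
| anom(p) | `Anom W p` | red(p) ∧ good(p) ∧ `a_p ≡ 1 (mod p)` |
| gvpar(p) | `GVPar W p` | some rational `p`-isogeny kernel character is (ramified at `p` ∧ even) ∨ (unramified at `p` ∧ odd) |
| (im) | `BigIm W p` | `∃ σ ∈ G_{ℚ(μ_{p^∞})}` with `T_pE/(σ−1)T_pE ≅ ℤ_p` (Burungale–Castella–Skinner 2025 (im); Yan–Zhu 2026 (Im)) |

Classes (`ClassX1 … ClassX12`, argument order `W p`; `X5`, `X8`, `X10` fix `p` inside the
predicate) transcribe CLASSES.md column 2 verbatim; where §a.2 writes "fails C3" for an `r = 1`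
pair with good irreducible `p ≥ 5` this is `¬ Semistable W` (C3 = Jetchev–Skinner–Wan needs
semistability), as the referee's table already reads.

Design notes. (1) `Addv` is "bad and not multiplicative"; for an elliptic `W` this is additive
reduction (Silverman VII.5.1 trichotomy), and it is the census bit `p² ∣ N`. (2) `Ram` is stated on
the minimal discriminant exactly as in `padicValRat_bsd_rank_zero` (Skinner–Urban 2014 (ram):
"`q ‖ N`, `q ≠ p`, `ρ̄_{E,p}` ramified at `q`" ⇔ `p ∤ ord_q(Δ_min)` by Tate's parametrisation,
Silverman *ATAEC* V.5 / Serre 1972 §1.12). (3) `GVPar` is phrased on a `Γ_ℚ`-stable subgroup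
`Φ ≤ E[p](ℚ̄)` of order `p` (a rational `p`-isogeny kernel): its character `ψ : Γ_ℚ → 𝔽_p^×` is
*unramified at `p`* iff every inertia group `I_𝔓 ≤ Γ_ℚ` at a prime `𝔓 ∣ p` of `\bar ℤ` acts
trivially on `Φ` (tree vocabulary `Ideal.inertia`, `IsDedekindDomain.HeightOneSpectrum.primesAbove`
of `GaloisRepresentations/IntegralGaloisAction`), and *even* / *odd* iff complex conjugation
(`IsComplexConjugation (Rat.castHom ℝ) c`, file `AbsGaloisGroup`) acts on `Φ` by `+1` / `−1`
(Greenberg–Vatsal, Invent. 142 (2000) Thm. 1.3: "the action of `G_ℚ` on `Φ` is either ramified at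
`p` and even, or unramified at `p` and odd"). (4) `BigIm` uses the tree's integral Tate module
`W.tateModule p` with `W.galoisRepTate p`; "`σ ∈ G_{ℚ(μ_{p^∞})}`" is "`σ` fixes every `p`-power
root of unity of `ℚ̄`". (5) CM-field splitting data for X12 are read off the `j`-invariant:
`cmFieldDiscrOfJ` extends the tree's nine-entry table `cmFieldDiscr` (file
`ComplexMultiplicationBurungaleFlachDescent`, maximal orders) to all thirteen CM `j`-invariants
(`cmJInvariants`, `Isogeny.lean`), the four non-maximal orders `-12, -16, -27, -28` having CM FIELD
discriminants `-3, -4, -3, -7` (Silverman, *Advanced Topics*, App. A §3; Cox, *Primes of the form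
x² + ny²*, §12.C). Nothing here duplicates Mathlib (pin v4.32.0: no reduction-type-at-a-prime, no
isogeny-character, no (im) vocabulary).

## References
* bsdN/HYPOTHESES.md v1 (2026-08-18), §Predicates; RESIDUAL-CASES.md v3 §a.0, §a.2; cell CLASSES.md.
* R. Greenberg, V. Vatsal, *On the Iwasawa invariants of elliptic curves*, Invent. Math. 142 (2000), Thm. 1.3 (`GreenbergVatsal2000`).
* A. Burungale, F. Castella, C. Skinner, IMRN 2025 rnaf082 = arXiv:2405.00270v2, p. 2, hypothesis (im) (`BurungaleCastellaSkinner2025`).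
* C. Skinner, E. Urban, Invent. Math. 195 (2014), Thm. 2 hypotheses (`SkinnerUrban2014`).
* J. H. Silverman, *AEC* VII.5.1; *Advanced Topics* App. A §3 (`SilvermanATAEC1994`).
-/

noncomputable section

open scoped Classical

open WeierstrassCurve Field IsDedekindDomain NumberField
open Literature.NumberTheory.GaloisRepresentations

namespace Literature.NumberTheory.EllipticCurves.Rank1Residual

/-! ### Reduction type at `p` -/

/-- good(p): `E` has good reduction at `p` (`p ∤ N`). bsdN/HYPOTHESES.md §Predicates. [folklore] -/
abbrev Good (W : WeierstrassCurve ℚ) (p : ℕ) [Fact p.Prime] : Prop := W.HasGoodReductionAtPrime p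

/-- mult(p): `E` has multiplicative reduction at `p` (`p ‖ N`). bsdN/HYPOTHESES.md §Predicates. [folklore] -/
abbrev Mult (W : WeierstrassCurve ℚ) (p : ℕ) [Fact p.Prime] : Prop := W.HasMultiplicativeReductionAtPrime p

/-- add(p): `E` has additive reduction at `p` (`p² ∣ N`): bad and not multiplicative (Silverman,
*AEC* VII.5.1: good / multiplicative / additive is a trichotomy for an elliptic curve).
bsdN/HYPOTHESES.md §Predicates. [folklore] -/
def Addv (W : WeierstrassCurve ℚ) (p : ℕ) [Fact p.Prime] : Prop := ¬ W.HasGoodReductionAtPrime p ∧ ¬ W.HasMultiplicativeReductionAtPrime p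

/-- ord(p): good ordinary reduction, `p ∤ N` and `p ∤ a_p` (on a globally minimal model, where the
tree's `frobeniusTrace` is `a_p`). bsdN/HYPOTHESES.md §Predicates. [folklore] -/
def GoodOrd (W : WeierstrassCurve ℚ) (p : ℕ) [Fact p.Prime] [W.IsGloballyMinimal] : Prop := W.HasGoodReductionAtPrime p ∧ ¬ (p : ℤ) ∣ W.frobeniusTrace p

/-- ss(p): good supersingular reduction, `p ∤ N` and `p ∣ a_p` (for `p ≥ 5` this is `a_p = 0` by
the Hasse bound). bsdN/HYPOTHESES.md §Predicates. [folklore] -/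
def GoodSS (W : WeierstrassCurve ℚ) (p : ℕ) [Fact p.Prime] [W.IsGloballyMinimal] : Prop := W.HasGoodReductionAtPrime p ∧ (p : ℤ) ∣ W.frobeniusTrace p

/-- sst: `E` is semistable, i.e. `N` is square-free: at every prime the reduction is good or
multiplicative. bsdN/HYPOTHESES.md §Predicates. [folklore] -/
def Semistable (W : WeierstrassCurve ℚ) : Prop :=
  ∀ ℓ : ℕ, (hℓ : ℓ.Prime) →
    (haveI : Fact ℓ.Prime := ⟨hℓ⟩; W.HasGoodReductionAtPrime ℓ ∨ W.HasMultiplicativeReductionAtPrime ℓ)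

/-! ### Image of the mod-`p` representation -/

/-- irr(p): `E[p]` is an irreducible `Γ_ℚ`-module. bsdN/HYPOTHESES.md §Predicates. [folklore] -/
abbrev Irr (W : WeierstrassCurve ℚ) (p : ℕ) [Fact p.Prime] : Prop := W.HasIrreducibleModPGaloisRep p

/-- red(p): `E[p]` is reducible, i.e. `E` admits a rational `p`-isogeny ("Eisenstein prime").
bsdN/HYPOTHESES.md §Predicates. [folklore] -/
def Red (W : WeierstrassCurve ℚ) (p : ℕ) [Fact p.Prime] : Prop := ¬ W.HasIrreducibleModPGaloisRep p

/-- surj(p): `ρ̄_{E,p} : Γ_ℚ → Aut(E[p]) ≅ GL₂(𝔽_p)` is surjective. bsdN/HYPOTHESES.md §Predicates. [folklore] -/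
abbrev Surj (W : WeierstrassCurve ℚ) (p : ℕ) [Fact p.Prime] : Prop := W.HasSurjectiveModNGaloisRep p

/-- ram(p): there is a prime `q ≠ p` of multiplicative reduction (`q ‖ N`) with `p ∤ v_q(Δ_min)`,
equivalently (Tate's parametrisation) `ρ̄_{E,p}` is ramified at `q` — hypothesis (ram)/(mult) of
Skinner–Urban 2014 Thm. 2, Skinner 2016 Thm. C (ii), Castella 2018 Thm. A, transcribed exactly as
in the tree's bsd.S30 `padicValRat_bsd_rank_zero`. bsdN/HYPOTHESES.md §Predicates.
[cite: SkinnerUrban2014, Thm. 2 (p. 3), second bullet] -/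
def Ram (W : WeierstrassCurve ℚ) (p : ℕ) [Fact p.Prime] [W.IsGloballyMinimal] : Prop :=
  ∃ ℓ : ℕ, ∃ _ : Fact ℓ.Prime, ℓ ≠ p ∧ W.HasMultiplicativeReductionAtPrime ℓ ∧
    ¬ p ∣ padicValInt ℓ W.minimalDiscriminantInt

/-- anom(p): `p` is an *anomalous Eisenstein prime of good reduction*: `E[p]` reducible, `p ∤ N`,
and `a_p ≡ 1 (mod p)` — equivalently the two characters of `E[p]^{ss}∣_{G_p}` are `{1, ω}`, the
case excluded by Castella–Grossi–Skinner 2025 Thm. D = Math. Ann. 393 (2025) §1.2, with Thm. A's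
hypothesis "`φ∣_{G_p} ≠ 1, ω`" (LaTeXML "Thm. 4" / "Thm. 1" of the arXiv v1 store text
`paper:arxiv-2303.04373`). RESIDUAL-CASES §a.0 (row T-CGS of HYPOTHESES.md). [folklore] -/
def Anom (W : WeierstrassCurve ℚ) (p : ℕ) [Fact p.Prime] [W.IsGloballyMinimal] : Prop :=
  ¬ W.HasIrreducibleModPGaloisRep p ∧ W.HasGoodReductionAtPrime p ∧
    (p : ℤ) ∣ W.frobeniusTrace p - 1

/-! ### Rational `p`-isogeny kernels and the Greenberg–Vatsal parity condition -/

/-- `Φ ≤ E[p](ℚ̄)` is (the kernel of) a *rational `p`-isogeny*: a `Γ_ℚ`-stable subgroup of order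
`p` of the geometric `p`-torsion. Greenberg–Vatsal 2000, p. 4 ("`E` admits a `ℚ`-isogeny of degree
`p` with kernel `Φ`"). [folklore] -/
def IsRationalLine (W : WeierstrassCurve ℚ) (p : ℕ) [Fact p.Prime] (Φ : AddSubgroup (geomTorsion W (p : ℤ))) : Prop :=
  Nat.card Φ = p ∧ ∀ σ : absoluteGaloisGroup ℚ, ∀ P ∈ Φ, σ • P ∈ Φ

/-- The kernel character of the line `Φ` is *unramified at `p`*: every inertia group
`I_𝔓 ≤ Γ_ℚ` at a prime `𝔓` of `\bar ℤ` above `p` (tree: `v.primesAbove`, Mathlib `Ideal.inertia`)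
acts trivially on `Φ`. Greenberg–Vatsal 2000, Thm. 1.3 ("unramified at `p`"). [folklore] -/
def LineUnramifiedAt (W : WeierstrassCurve ℚ) (p : ℕ) [Fact p.Prime] (Φ : AddSubgroup (geomTorsion W (p : ℤ))) : Prop :=
  ∀ v : HeightOneSpectrum (𝓞 ℚ), (p : 𝓞 ℚ) ∈ v.asIdeal →
    ∀ 𝔓 ∈ v.primesAbove, ∀ σ ∈ 𝔓.inertia (absoluteGaloisGroup ℚ), ∀ P ∈ Φ, σ • P = P

/-- The kernel character of `Φ` is *even*: complex conjugation acts trivially on `Φ` (all complex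
conjugations of `Γ_ℚ` are conjugate and the character is abelian, so "every" = "some").
Greenberg–Vatsal 2000, Thm. 1.3 ("even"). [folklore] -/
def LineEven (W : WeierstrassCurve ℚ) (p : ℕ) [Fact p.Prime] (Φ : AddSubgroup (geomTorsion W (p : ℤ))) : Prop :=
  ∀ c : absoluteGaloisGroup ℚ, IsComplexConjugation (Rat.castHom ℝ) c → ∀ P ∈ Φ, c • P = P

/-- The kernel character of `Φ` is *odd*: complex conjugation acts by `−1` on `Φ`.
Greenberg–Vatsal 2000, Thm. 1.3 ("odd"). [folklore] -/
def LineOdd (W : WeierstrassCurve ℚ) (p : ℕ) [Fact p.Prime] (Φ : AddSubgroup (geomTorsion W (p : ℤ))) : Prop :=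
  ∀ c : absoluteGaloisGroup ℚ, IsComplexConjugation (Rat.castHom ℝ) c → ∀ P ∈ Φ, c • P = -P

/-- gvpar(p): SOME rational `p`-isogeny kernel `Φ` of `E` has character "either ramified at `p` and
even, or unramified at `p` and odd" — the hypothesis of Greenberg–Vatsal, Invent. Math. 142 (2000),
Thm. 1.3, decided exactly by the lane's `gv_condition` (HYPOTHESES.md row T-GV0).
[cite: GreenbergVatsal2000, Thm. 1.3 (hypothesis on Φ)] -/
def GVPar (W : WeierstrassCurve ℚ) (p : ℕ) [Fact p.Prime] : Prop :=
  ∃ Φ : AddSubgroup (geomTorsion W (p : ℤ)), IsRationalLine W p Φ ∧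
    ((¬ LineUnramifiedAt W p Φ ∧ LineEven W p Φ) ∨ (LineUnramifiedAt W p Φ ∧ LineOdd W p Φ))

/-! ### The `p`-adic image condition (im) -/

/-- (im): "there exists `σ ∈ G_{ℚ(μ_{p^∞})}` such that `T_pE/(σ − 1)T_pE` is a free `ℤ_p`-module of
rank one" (Burungale–Castella–Skinner 2025, p. 2; Yan–Zhu 2026, (Im)): `σ ∈ Γ_ℚ` fixes every
`p`-power root of unity of `ℚ̄` and the coinvariant quotient of the integral Tate module
`W.tateModule p` under `ρ_{E,p}(σ) − 1` is `ℤ_p`-linearly isomorphic to `ℤ_p`. For `p ≥ 5` it is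
implied by surj(p) (then `ρ_{E,p^∞}(Γ_ℚ) = GL₂(ℤ_p) ∋ (1 1; 0 1)`, Serre), and it forces
`p ∣ #ρ̄_{E,p}(Γ_ℚ)` (RESIDUAL-CASES (a-S) S1 F1). [cite: BurungaleCastellaSkinner2025, p. 2, hypothesis (im)] -/
def BigIm (W : WeierstrassCurve ℚ) (p : ℕ) [Fact p.Prime] : Prop :=
  ∃ σ : absoluteGaloisGroup ℚ,
    (∀ ζ : AlgebraicClosure ℚ, ∀ n : ℕ, ζ ^ p ^ n = 1 → absoluteGaloisGroup.toAlgEquiv ℚ σ ζ = ζ) ∧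
    Nonempty ((W.tateModule p ⧸ LinearMap.range (W.galoisRepTate p σ - LinearMap.id)) ≃ₗ[ℤ_[p]] ℤ_[p])

/-! ### CM field data read off the `j`-invariant (for X12) -/

/-- The fundamental discriminant `d_K` of the CM FIELD `K = End(E_{ℚ̄}) ⊗ ℚ` of an elliptic curve
over `ℚ` with `j(E) = j ∈ cmJInvariants` (all thirteen CM `j`-invariants; the orders of
discriminant `-12, -16, -27, -28` have fields `ℚ(√-3), ℚ(i), ℚ(√-3), ℚ(√-7)`):
`0, 54000, -12288000 ↦ -3`; `1728, 287496 ↦ -4`; `-3375, 16581375 ↦ -7`; `8000 ↦ -8`;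
`-32768 ↦ -11`; `-884736 ↦ -19`; `-884736000 ↦ -43`; `-147197952000 ↦ -67`;
`-262537412640768000 ↦ -163`; junk `0` otherwise. Agrees with the tree's `cmFieldDiscr` on the nine
maximal-order values. Silverman, *Advanced Topics*, App. A §3; Cox, §12.C.
[cite: SilvermanATAEC1994, App. A §3 (table of CM j-invariants)] -/
def cmFieldDiscrOfJ (j : ℚ) : ℤ :=
  if j = 0 ∨ j = 54000 ∨ j = -12288000 then -3
  else if j = 1728 ∨ j = 287496 then -4
  else if j = -3375 ∨ j = 16581375 then -7
  else if j = 8000 then -8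
  else if j = -32768 then -11
  else if j = -884736 then -19
  else if j = -884736000 then -43
  else if j = -147197952000 then -67
  else if j = -262537412640768000 then -163
  else 0

/-- `p` is ramified in the CM field `K` of `E`: `p ∣ d_K`. (X12 corner "p ramified in K".)
Cox, *Primes of the form x² + ny²*, Prop. 5.16 / Cor. 5.17. [folklore] -/
def CMRamified (W : WeierstrassCurve ℚ) [W.IsElliptic] (p : ℕ) : Prop := (p : ℤ) ∣ cmFieldDiscrOfJ W.j

/-- `p` splits in the CM field `K = ℚ(√d_K)` of `E`: `p ∤ d_K` and `d_K` is a square mod `p`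
(odd `p`), resp. `d_K ≡ 1 (mod 8)` (`p = 2`). For a CM curve these are the (potentially) ORDINARY
primes. Cox, Prop. 5.16 / Cor. 5.17. [folklore] -/
def CMSplit (W : WeierstrassCurve ℚ) [W.IsElliptic] (p : ℕ) : Prop :=
  ¬ (p : ℤ) ∣ cmFieldDiscrOfJ W.j ∧
    (if p = 2 then cmFieldDiscrOfJ W.j % 8 = 1 else IsSquare ((cmFieldDiscrOfJ W.j : ZMod p)))

/-- `p` is inert in the CM field of `E`: neither ramified nor split (the (potentially)
SUPERSINGULAR primes of a CM curve). Cox, Prop. 5.16 / Cor. 5.17. [folklore] -/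
def CMInert (W : WeierstrassCurve ℚ) [W.IsElliptic] (p : ℕ) : Prop := ¬ CMRamified W p ∧ ¬ CMSplit W p

/-! ### The residual classes X1–X12 (RESIDUAL-CASES §a.2 v3 = CLASSES.md, column 2, verbatim) -/

/-- **X1 — Eisenstein anomalous, good `p`**: `p > 2 ∧ red(p) ∧ good(p) ∧ anom(p) ∧ ¬(r = 0 ∧ gvpar(p))`
(both ranks; e.g. `11a1@5`, `14a1@3`, `26b1@7`). Label at input: COMBINATION-SHAPED (announced:
Keller–Yin arXiv:2402.12781 Thm. 3, PRE). RESIDUAL-CASES §a.2 row X1. [folklore] -/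
def ClassX1 (W : WeierstrassCurve ℚ) (p : ℕ) [Fact p.Prime] [W.IsGloballyMinimal] : Prop :=
  2 < p ∧ Red W p ∧ Good W p ∧ Anom W p ∧ ¬ (W.analyticRank = 0 ∧ GVPar W p)

/-- **X2 — Eisenstein multiplicative**: `p odd ∧ red(p) ∧ mult(p)` (both ranks). Label:
CONSTRUCTION-SHAPED. RESIDUAL-CASES §a.2 row X2. [folklore] -/
def ClassX2 (W : WeierstrassCurve ℚ) (p : ℕ) [Fact p.Prime] : Prop := p ≠ 2 ∧ Red W p ∧ Mult W p

/-- **X3 — Eisenstein additive**: `red(p) ∧ add(p)`. Label: CONSTRUCTION-SHAPED.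
RESIDUAL-CASES §a.2 row X3. [folklore] -/
def ClassX3 (W : WeierstrassCurve ℚ) (p : ℕ) [Fact p.Prime] : Prop := Red W p ∧ Addv W p

/-- **X4 — additive, irreducible**: `add(p) ∧ irr(p)`, `p` odd (both ranks). Label:
CONSTRUCTION-SHAPED (r = 0 per curve: Kim AJM 2026 Thm. 1.8). RESIDUAL-CASES §a.2 row X4. [folklore] -/
def ClassX4 (W : WeierstrassCurve ℚ) (p : ℕ) [Fact p.Prime] : Prop := p ≠ 2 ∧ Addv W p ∧ Irr W p

/-- **X5 — `p = 2`** (beyond a sharp `2`-descent, C13; the class is every `E` at `p = 2`). Label: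
CONSTRUCTION-SHAPED. RESIDUAL-CASES §a.2 row X5. [folklore] -/
def ClassX5 (_W : WeierstrassCurve ℚ) (p : ℕ) : Prop := p = 2

/-- **X6 — supersingular, semistable**: `ss(p) ∧ sst ∧ (p ≥ 5 ∨ a_3 = 0)` (irr(p) is automatic).
Label: CONSTRUCTION-SHAPED, discharge ANNOUNCED (BSTW arXiv:2409.01350 Thm. 1.3/1.5, PRE).
RESIDUAL-CASES §a.2 row X6. [folklore] -/
def ClassX6 (W : WeierstrassCurve ℚ) (p : ℕ) [Fact p.Prime] [W.IsGloballyMinimal] : Prop :=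
  GoodSS W p ∧ Semistable W ∧ (5 ≤ p ∨ W.frobeniusTrace 3 = 0)

/-- **X7 — supersingular, non-semistable**: `ss(p) ∧ ¬sst`. Label: CONSTRUCTION-SHAPED.
RESIDUAL-CASES §a.2 row X7. [folklore] -/
def ClassX7 (W : WeierstrassCurve ℚ) (p : ℕ) [Fact p.Prime] [W.IsGloballyMinimal] : Prop := GoodSS W p ∧ ¬ Semistable W

/-- **X8 — `p = 3` supersingular with `a_3 = ±3`**: `ss(3) ∧ a_3 ≠ 0` (the only supersingular case
with `a_p ≠ 0`). Label: CONSTRUCTION-SHAPED (Sprung 2024 conditional). RESIDUAL-CASES §a.2 row X8. [folklore] -/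
def ClassX8 (W : WeierstrassCurve ℚ) (p : ℕ) [Fact p.Prime] [W.IsGloballyMinimal] : Prop := p = 3 ∧ GoodSS W 3 ∧ W.frobeniusTrace 3 ≠ 0

/-- **X9 — residually small but irreducible image at good ordinary `p ≥ 5`**:
`¬cm ∧ ord(p) ∧ p ≥ 5 ∧ irr(p) ∧ ¬surj(p)` (⇒ ¬ram, ¬(im), ¬zhang automatically), and for `r = 1`
additionally "¬sst ∨ fails C3", i.e. `¬sst` (C3 = Jetchev–Skinner–Wan needs only semistability
beyond good, irr, `p ≥ 5`). Label: COMBINATION-SHAPED (confidence low; [BS24] not out).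
RESIDUAL-CASES §a.2 row X9 (v3, referee A P5). [folklore] -/
def ClassX9 (W : WeierstrassCurve ℚ) (p : ℕ) [Fact p.Prime] [W.IsGloballyMinimal] : Prop :=
  ¬ W.HasCM ∧ GoodOrd W p ∧ 5 ≤ p ∧ Irr W p ∧ ¬ Surj W p ∧
    (W.analyticRank = 1 → ¬ Semistable W)

/-- **X10 — `p = 3` good ordinary, irreducible, off the printed floor**:
`ord(3) ∧ irr(3) ∧ [(r = 0 ∧ ¬ram(3)) ∨ (r = 1 ∧ ¬sst)]`. Label: COMBINATION-SHAPED (low-medium).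
RESIDUAL-CASES §a.2 row X10. [folklore] -/
def ClassX10 (W : WeierstrassCurve ℚ) (p : ℕ) [Fact p.Prime] [W.IsGloballyMinimal] : Prop :=
  p = 3 ∧ GoodOrd W 3 ∧ Irr W 3 ∧
    ((W.analyticRank = 0 ∧ ¬ Ram W 3) ∨ (W.analyticRank = 1 ∧ ¬ Semistable W))

/-- **X11 — multiplicative `p` without a second ramified multiplicative prime, or rank 1 outside
semistability / at `p = 3`**: `mult(p) ∧ irr(p) ∧ [¬ram(p) ∨ (r = 1 ∧ ¬sst) ∨ (r = 1 ∧ p = 3)]`.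
Label: COMBINATION-SHAPED (medium; `p = 3` low). RESIDUAL-CASES §a.2 row X11. [folklore] -/
def ClassX11 (W : WeierstrassCurve ℚ) (p : ℕ) [Fact p.Prime] [W.IsGloballyMinimal] : Prop :=
  Mult W p ∧ Irr W p ∧
    (¬ Ram W p ∨ (W.analyticRank = 1 ∧ ¬ Semistable W) ∨ (W.analyticRank = 1 ∧ p = 3))

/-- **X12 — CM, rank 1, `p ∣ 6·d_K·N`**:
`cm ∧ r = 1 ∧ (p = 2 ∨ (p = 3 ∧ 3 not split in K) ∨ p ramified in K ∨ p ∣ N)` with `K` the CM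
field (read off `W.j`, `cmFieldDiscrOfJ`) and `p ∣ N` ⇔ bad reduction at `p`. Label:
CONSTRUCTION-SHAPED. RESIDUAL-CASES §a.2 row X12. [folklore] -/
def ClassX12 (W : WeierstrassCurve ℚ) [W.IsElliptic] (p : ℕ) [Fact p.Prime] : Prop :=
  W.HasCM ∧ W.analyticRank = 1 ∧
    (p = 2 ∨ (p = 3 ∧ ¬ CMSplit W 3) ∨ CMRamified W p ∨ ¬ Good W p)

/-! ### API: unfoldings and the elementary implications used by every class file -/

variable (W : WeierstrassCurve ℚ) (p : ℕ) [Fact p.Prime]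

/-- Unfolding: red(p) is the negation of irr(p). bsdN/HYPOTHESES.md §Predicates. [folklore] -/
theorem red_iff : Red W p ↔ ¬ Irr W p := Iff.rfl

/-- Unfolding: add(p) is "neither good nor multiplicative". bsdN/HYPOTHESES.md §Predicates. [folklore] -/
theorem addv_iff : Addv W p ↔ ¬ Good W p ∧ ¬ Mult W p := Iff.rfl

/-- Unfolding of anom(p). RESIDUAL-CASES §a.0. [folklore] -/
theorem anom_iff [W.IsGloballyMinimal] :
    Anom W p ↔ Red W p ∧ Good W p ∧ (p : ℤ) ∣ W.frobeniusTrace p - 1 := Iff.rfl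

/-- An anomalous Eisenstein prime of good reduction is ordinary: `a_p ≡ 1 (mod p)` forces
`p ∤ a_p`. (RESIDUAL-CASES §a.1 C6: "red(p) ∧ good(p) ∧ p > 2 ⇒ ord(p)" in the anomalous case.)
[folklore] -/
theorem goodOrd_of_anom [W.IsGloballyMinimal] (h : Anom W p) : GoodOrd W p := by
  refine ⟨h.2.1, fun hdvd => ?_⟩
  have h1 : (p : ℤ) ∣ 1 := by
    have := dvd_sub hdvd h.2.2
    simpa using this
  have hp : (p : ℤ) ≤ 1 := Int.le_of_dvd one_pos h1
  have := (Fact.out : p.Prime).two_le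
  omega

/-- An additive prime is not a good prime. Silverman, *AEC* VII.5.1. [folklore] -/
theorem not_good_of_addv (h : Addv W p) : ¬ Good W p := h.1

/-- An additive prime is not a multiplicative prime. Silverman, *AEC* VII.5.1. [folklore] -/
theorem not_mult_of_addv (h : Addv W p) : ¬ Mult W p := h.2

/-- In class X10 the prime is `3`. RESIDUAL-CASES §a.2 row X10. [folklore] -/
theorem ClassX10.p_eq [W.IsGloballyMinimal] (h : ClassX10 W p) : p = 3 := h.1

/-- In class X8 the prime is `3`. RESIDUAL-CASES §a.2 row X8. [folklore] -/
theorem ClassX8.p_eq [W.IsGloballyMinimal] (h : ClassX8 W p) : p = 3 := h.1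

end Literature.NumberTheory.EllipticCurves.Rank1Residual
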